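import Mathlib
import HarnessLib
import Summits.NavierStokesRegularity.NavierStokesRegularity.Theorems.PoloidalWindowDoorPoloidalWindowRigidityLargeScaleEnergyBootstrapFloor

/-!
# Route `PoloidalWindowDoor`, crux `PoloidalWindowRigidity` (K2, stmt-NavierStokesRegularity-19708) — whole-class theorem:
# UNIFORM CONSTANTS for the large-scale energy bootstrap — one `K = K(C, α)` for the whole class of rate `C`

Cell ns-regularity-ideate, seat ns-poloidal-K2-p3 gen 3 (stub-worker under the K2 lead; file landed
`--supports stmt-NavierStokesRegularity-19708` as a helper).  `…LargeScaleEnergyBootstrapLevels` / `…BootstrapFloor` give,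
for EACH profile `v`, a constant `K` with `∫_{B̄(0,R)}‖v(t)‖² ≤ K R^α (−t)^{−(α−1)/2}`; the proofs in fact produce `K`
depending on the Type-I rate `C` and on `α` only (ref3 SCORE-wave-20h).  This file records the uniform statements,
which is what compactness / zoom-out / blow-down arguments on SEQUENCES of class profiles consume:
* `level_zoom` — the level bounds are invariant under the parabolic zooms `v ↦ c v(c²·, c·)`;
* `exists_uniform_levelTwo` — `∃ K(C): ∀ v ∈ 𝔓(C)`, LEVEL `2` with constant `K`;
* `uniform_levelStep`, `uniform_levelStepTwo` — `∀ α K₀ ∃ K'(C,α,K₀): ∀ v ∈ 𝔓(C)` at LEVEL `α` (constant `K₀`),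
  LEVEL `1+α/3` resp. `(1+α)/2` with constant `K'`;
* `exists_uniform_level_of_gt_one` — **`∀ α ∈ (1,3] ∃ K(C,α) ≥ 0: ∀ v ∈ 𝔓(C), ∀ t < 0, ∀ R > 0,
  ∫_{B̄(0,R)}‖v(t)‖² ≤ K R^α (−t)^{−(α−1)/2}`.**
(`𝔓(C)`: rate `‖v(t,x)‖ ≤ C/√(−t)`, continuous on the open slab, unit-viscosity Oseen-mild, divergence-free.)

WHAT THIS IS NOT: not a claim about Navier–Stokes regularity and not the open residue S2⁗ — bookkeeping of constants
(bears_on LADDER-NS N0; whole-class tool).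
-/

noncomputable section

-- the summit and its single sub-problem share the name (CONVENTIONS §1), as in every Theorems file
set_option linter.dupNamespace false

namespace Summit.NavierStokesRegularity.NavierStokesRegularity.Theorems.PoloidalWindowDoorPoloidalWindowRigidityLargeScaleEnergyBootstrapUniform

open MeasureTheory Set Function Filter Topology Metric
open scoped RealInnerProductSpace
open Literature.Analysis Literature.Analysis.FluidPDE Literature.Analysis.UnboundedOperators
open Summit.NavierStokesRegularity.NavierStokesRegularity.Theorems.PoloidalWindowDoorPoloidalWindowRigidityLargeScaleEnergyBootstrapScaling
open Summit.NavierStokesRegularity.NavierStokesRegularity.Theorems.PoloidalWindowDoorPoloidalWindowRigidityLargeScaleEnergyBootstrapLevels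
open Summit.NavierStokesRegularity.NavierStokesRegularity.Theorems.PoloidalWindowDoorPoloidalWindowRigidityLargeScaleEnergyBootstrapFloor

variable {C : ℝ} {v : ℝ → EuclideanSpace ℝ (Fin 3) → EuclideanSpace ℝ (Fin 3)}

/-! ### Zoom invariance of the levels -/

/-- **The level bounds are zoom-invariant**: if `∫_{B̄(0,R)}‖v(t)‖² ≤ K₀R^α(−t)^{−(α−1)/2}` for all `t < 0`, `R > 0`,
then the same holds, with the same `K₀`, for `c v(c²·, c·)` (`c > 0`). -/
theorem level_zoom {K₀ α : ℝ}
    (hL : ∀ t < 0, ∀ R : ℝ, 0 < R → ∫ x in closedBall (0 : EuclideanSpace ℝ (Fin 3)) R, ‖v t x‖ ^ 2 ≤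
      K₀ * R ^ α * (-t) ^ (-((α - 1) / 2))) {c : ℝ} (hc : 0 < c) :
    ∀ t < 0, ∀ R : ℝ, 0 < R →
      ∫ x in closedBall (0 : EuclideanSpace ℝ (Fin 3)) R, ‖(fun s y => c • v (c ^ 2 * s) (c • y)) t x‖ ^ 2 ≤
        K₀ * R ^ α * (-t) ^ (-((α - 1) / 2)) := by
  intro t ht R hR
  have hct : c ^ 2 * t < 0 := mul_neg_of_pos_of_neg (pow_pos hc 2) ht
  have hb := hL (c ^ 2 * t) hct (c * R) (mul_pos hc hR)
  show ∫ x in closedBall (0 : EuclideanSpace ℝ (Fin 3)) R, ‖c • v (c ^ 2 * t) (c • x)‖ ^ 2 ≤ _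
  rw [setIntegral_closedBall_norm_sq_zoom v hc t hR.le]
  have ht0 : 0 < -t := neg_pos.2 ht
  have e : c⁻¹ * (K₀ * (c * R) ^ α * (-(c ^ 2 * t)) ^ (-((α - 1) / 2))) =
      K₀ * R ^ α * (-t) ^ (-((α - 1) / 2)) := by
    rw [Real.mul_rpow hc.le hR.le, show (-(c ^ 2 * t)) = c ^ 2 * (-t) by ring,
      Real.mul_rpow (pow_nonneg hc.le 2) ht0.le, show (c ^ 2 : ℝ) = c ^ (2 : ℝ) by norm_cast,
      ← Real.rpow_mul hc.le]
    have hcc : c⁻¹ * c ^ α * c ^ ((2 : ℝ) * -((α - 1) / 2)) = 1 := by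
      rw [← Real.rpow_neg_one, ← Real.rpow_add hc, ← Real.rpow_add hc,
        show (-1 : ℝ) + α + 2 * -((α - 1) / 2) = 0 by ring, Real.rpow_zero]
    calc c⁻¹ * (K₀ * (c ^ α * R ^ α) * (c ^ ((2 : ℝ) * -((α - 1) / 2)) * (-t) ^ (-((α - 1) / 2))))
        = (c⁻¹ * c ^ α * c ^ ((2 : ℝ) * -((α - 1) / 2))) * (K₀ * R ^ α * (-t) ^ (-((α - 1) / 2))) := by ring
      _ = K₀ * R ^ α * (-t) ^ (-((α - 1) / 2)) := by rw [hcc, one_mul]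
  calc c⁻¹ * ∫ y in closedBall (0 : EuclideanSpace ℝ (Fin 3)) (c * R), ‖v (c ^ 2 * t) y‖ ^ 2
      ≤ c⁻¹ * (K₀ * (c * R) ^ α * (-(c ^ 2 * t)) ^ (-((α - 1) / 2))) :=
        mul_le_mul_of_nonneg_left hb (inv_nonneg.2 hc.le)
    _ = K₀ * R ^ α * (-t) ^ (-((α - 1) / 2)) := e

/-! ### Uniform LEVEL 2 -/

/-- **Uniform LEVEL 2.**  For `C ≥ 0` there is `K = K(C) ≥ 0` such that EVERY profile of the class with rate `C`
satisfies `∫_{B̄(0,R)}‖v(t)‖² ≤ K R²(−t)^{−1/2}` for all `t < 0`, `R > 0`. -/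
theorem exists_uniform_levelTwo (C : ℝ) (hC0 : 0 ≤ C) : ∃ K : ℝ, 0 ≤ K ∧
    ∀ v : ℝ → EuclideanSpace ℝ (Fin 3) → EuclideanSpace ℝ (Fin 3), HasTypeITimeDecay C v →
      ContinuousOn (uncurry v) (Iio (0 : ℝ) ×ˢ univ) →
      (∀ s t : ℝ, s < t → t < 0 → ∀ x, v t x = heatExtension (v s) (t - s) x - oseenDuhamel 1 s v v t x) →
      (∀ t < 0, VectorCalculus.IsDivFree (v t)) →
      ∀ t < 0, ∀ R : ℝ, 0 < R →
        ∫ x in closedBall (0 : EuclideanSpace ℝ (Fin 3)) R, ‖v t x‖ ^ 2 ≤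
          K * R ^ (2 : ℝ) * (-t) ^ (-(((2 : ℝ) - 1) / 2)) := by
  obtain ⟨K₂, hK₂0, H⟩ := levelTwo_at_neg_one C hC0
  set V₁ : ℝ := volume.real (closedBall (0 : EuclideanSpace ℝ (Fin 3)) 1) with hV₁
  have hV₁0 : 0 ≤ V₁ := measureReal_nonneg
  refine ⟨K₂ + C ^ 2 * V₁, by positivity, fun v hrate hcont hmild hdiv t ht R hR => ?_⟩
  have hX : 0 ≤ R ^ (2 : ℝ) * (-t) ^ (-(((2 : ℝ) - 1) / 2)) :=
    mul_nonneg (Real.rpow_nonneg hR.le _) (Real.rpow_nonneg (by linarith) _)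
  rcases le_or_gt (Real.sqrt (-t)) R with hle | hlt
  · have h := level_of_level_at_neg_one
      (P := fun w => HasTypeITimeDecay C w ∧ ContinuousOn (uncurry w) (Iio (0 : ℝ) ×ˢ univ) ∧
        (∀ s t : ℝ, s < t → t < 0 → ∀ x, w t x = heatExtension (w s) (t - s) x - oseenDuhamel 1 s w w t x) ∧
        (∀ t < 0, VectorCalculus.IsDivFree (w t)))
      (fun w hw c hc => class_zoom₀ hw.1 hw.2.1 hw.2.2.1 hw.2.2.2 hc)
      (fun w hw R hR => H w hw.1 hw.2.1 hw.2.2.1 hw.2.2.2 R hR) ⟨hrate, hcont, hmild, hdiv⟩ ht hle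
    calc _ ≤ K₂ * R ^ (2 : ℝ) * (-t) ^ (-(((2 : ℝ) - 1) / 2)) := h
      _ ≤ (K₂ + C ^ 2 * V₁) * R ^ (2 : ℝ) * (-t) ^ (-(((2 : ℝ) - 1) / 2)) := by
          rw [mul_assoc, mul_assoc]; exact mul_le_mul_of_nonneg_right (by nlinarith) hX
  · have h := setIntegral_closedBall_norm_sq_le_of_small hrate (α := 2) (by norm_num) ht hR hlt.le
    calc _ ≤ C ^ 2 * V₁ * R ^ (2 : ℝ) * (-t) ^ (-(((2 : ℝ) - 1) / 2)) := h
      _ ≤ (K₂ + C ^ 2 * V₁) * R ^ (2 : ℝ) * (-t) ^ (-(((2 : ℝ) - 1) / 2)) := by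
          rw [mul_assoc (K₂ + _), mul_assoc (C ^ 2 * V₁)]; exact mul_le_mul_of_nonneg_right (by linarith) hX

/-! ### Uniform steps -/

/-- **Uniform step `α ↦ 1 + α/3`.**  For `C ≥ 0`, `K₀ ≥ 0`, `1 < α < 3` there is `K' = K'(C, α, K₀) ≥ 0` such that
every profile of the class (rate `C`) at LEVEL `α` with constant `K₀` is at LEVEL `1 + α/3` with constant `K'`. -/
theorem uniform_levelStep (C K₀ α : ℝ) (hC0 : 0 ≤ C) (hK0 : 0 ≤ K₀) (hα1 : 1 < α) (hα3 : α < 3) :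
    ∃ K' : ℝ, 0 ≤ K' ∧
    ∀ v : ℝ → EuclideanSpace ℝ (Fin 3) → EuclideanSpace ℝ (Fin 3), HasTypeITimeDecay C v →
      ContinuousOn (uncurry v) (Iio (0 : ℝ) ×ˢ univ) →
      (∀ s t : ℝ, s < t → t < 0 → ∀ x, v t x = heatExtension (v s) (t - s) x - oseenDuhamel 1 s v v t x) →
      (∀ t < 0, VectorCalculus.IsDivFree (v t)) →
      (∀ t < 0, ∀ R : ℝ, 0 < R → ∫ x in closedBall (0 : EuclideanSpace ℝ (Fin 3)) R, ‖v t x‖ ^ 2 ≤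
        K₀ * R ^ α * (-t) ^ (-((α - 1) / 2))) →
      ∀ t < 0, ∀ R : ℝ, 0 < R →
        ∫ x in closedBall (0 : EuclideanSpace ℝ (Fin 3)) R, ‖v t x‖ ^ 2 ≤
          K' * R ^ (1 + α / 3) * (-t) ^ (-(((1 + α / 3) - 1) / 2)) := by
  obtain ⟨K', hK'0, H⟩ := levelStep_at_neg_one C K₀ α hC0 hK0 hα1 hα3
  set V₁ : ℝ := volume.real (closedBall (0 : EuclideanSpace ℝ (Fin 3)) 1) with hV₁
  have hV₁0 : 0 ≤ V₁ := measureReal_nonneg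
  refine ⟨K' + C ^ 2 * V₁, by positivity, fun v hrate hcont hmild hdiv hL t ht R hR => ?_⟩
  have hX : 0 ≤ R ^ (1 + α / 3) * (-t) ^ (-(((1 + α / 3) - 1) / 2)) :=
    mul_nonneg (Real.rpow_nonneg hR.le _) (Real.rpow_nonneg (by linarith) _)
  rcases le_or_gt (Real.sqrt (-t)) R with hle | hlt
  · have h := level_of_level_at_neg_one (K := K') (α := 1 + α / 3)
      (P := fun w => (HasTypeITimeDecay C w ∧ ContinuousOn (uncurry w) (Iio (0 : ℝ) ×ˢ univ) ∧
        (∀ s t : ℝ, s < t → t < 0 → ∀ x, w t x = heatExtension (w s) (t - s) x - oseenDuhamel 1 s w w t x) ∧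
        (∀ t < 0, VectorCalculus.IsDivFree (w t))) ∧
        (∀ t < 0, ∀ R : ℝ, 0 < R → ∫ x in closedBall (0 : EuclideanSpace ℝ (Fin 3)) R, ‖w t x‖ ^ 2 ≤
          K₀ * R ^ α * (-t) ^ (-((α - 1) / 2))))
      (fun w hw c hc => ⟨class_zoom₀ hw.1.1 hw.1.2.1 hw.1.2.2.1 hw.1.2.2.2 hc, level_zoom hw.2 hc⟩)
      (fun w hw R hR => H w hw.1.1 hw.1.2.1 hw.1.2.2.1 hw.1.2.2.2 hw.2 R hR)
      ⟨⟨hrate, hcont, hmild, hdiv⟩, hL⟩ ht hle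
    calc _ ≤ K' * R ^ (1 + α / 3) * (-t) ^ (-(((1 + α / 3) - 1) / 2)) := h
      _ ≤ (K' + C ^ 2 * V₁) * R ^ (1 + α / 3) * (-t) ^ (-(((1 + α / 3) - 1) / 2)) := by
          rw [mul_assoc, mul_assoc]; exact mul_le_mul_of_nonneg_right (by nlinarith) hX
  · have h := setIntegral_closedBall_norm_sq_le_of_small hrate (α := 1 + α / 3) (by linarith) ht hR hlt.le
    calc _ ≤ C ^ 2 * V₁ * R ^ (1 + α / 3) * (-t) ^ (-(((1 + α / 3) - 1) / 2)) := h
      _ ≤ (K' + C ^ 2 * V₁) * R ^ (1 + α / 3) * (-t) ^ (-(((1 + α / 3) - 1) / 2)) := by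
          rw [mul_assoc (K' + _), mul_assoc (C ^ 2 * V₁)]; exact mul_le_mul_of_nonneg_right (by linarith) hX

/-- **Uniform floor step `α ↦ (1+α)/2`.**  For `K₀ ≥ 0`, `1 < α < 3` there is `K' = K'(C, α, K₀) ≥ 0` such
that every profile of the class (rate `C`) at LEVEL `α` with constant `K₀` is at LEVEL `(1+α)/2` with constant `K'`. -/
theorem uniform_levelStepTwo (C K₀ α : ℝ) (hK0 : 0 ≤ K₀) (hα1 : 1 < α) (hα3 : α < 3) :
    ∃ K' : ℝ, 0 ≤ K' ∧
    ∀ v : ℝ → EuclideanSpace ℝ (Fin 3) → EuclideanSpace ℝ (Fin 3), HasTypeITimeDecay C v →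
      ContinuousOn (uncurry v) (Iio (0 : ℝ) ×ˢ univ) →
      (∀ s t : ℝ, s < t → t < 0 → ∀ x, v t x = heatExtension (v s) (t - s) x - oseenDuhamel 1 s v v t x) →
      (∀ t < 0, VectorCalculus.IsDivFree (v t)) →
      (∀ t < 0, ∀ R : ℝ, 0 < R → ∫ x in closedBall (0 : EuclideanSpace ℝ (Fin 3)) R, ‖v t x‖ ^ 2 ≤
        K₀ * R ^ α * (-t) ^ (-((α - 1) / 2))) →
      ∀ t < 0, ∀ R : ℝ, 0 < R →
        ∫ x in closedBall (0 : EuclideanSpace ℝ (Fin 3)) R, ‖v t x‖ ^ 2 ≤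
          K' * R ^ ((1 + α) / 2) * (-t) ^ (-((((1 + α) / 2) - 1) / 2)) := by
  obtain ⟨K', hK'0, H⟩ := levelStepTwo_at_neg_one C K₀ α hK0 hα1 hα3
  set V₁ : ℝ := volume.real (closedBall (0 : EuclideanSpace ℝ (Fin 3)) 1) with hV₁
  have hV₁0 : 0 ≤ V₁ := measureReal_nonneg
  refine ⟨K' + C ^ 2 * V₁, by positivity, fun v hrate hcont hmild hdiv hL t ht R hR => ?_⟩
  have hX : 0 ≤ R ^ ((1 + α) / 2) * (-t) ^ (-((((1 + α) / 2) - 1) / 2)) :=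
    mul_nonneg (Real.rpow_nonneg hR.le _) (Real.rpow_nonneg (by linarith) _)
  rcases le_or_gt (Real.sqrt (-t)) R with hle | hlt
  · have h := level_of_level_at_neg_one (K := K') (α := (1 + α) / 2)
      (P := fun w => (HasTypeITimeDecay C w ∧ ContinuousOn (uncurry w) (Iio (0 : ℝ) ×ˢ univ) ∧
        (∀ s t : ℝ, s < t → t < 0 → ∀ x, w t x = heatExtension (w s) (t - s) x - oseenDuhamel 1 s w w t x) ∧
        (∀ t < 0, VectorCalculus.IsDivFree (w t))) ∧
        (∀ t < 0, ∀ R : ℝ, 0 < R → ∫ x in closedBall (0 : EuclideanSpace ℝ (Fin 3)) R, ‖w t x‖ ^ 2 ≤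
          K₀ * R ^ α * (-t) ^ (-((α - 1) / 2))))
      (fun w hw c hc => ⟨class_zoom₀ hw.1.1 hw.1.2.1 hw.1.2.2.1 hw.1.2.2.2 hc, level_zoom hw.2 hc⟩)
      (fun w hw R hR => H w hw.1.1 hw.1.2.1 hw.1.2.2.1 hw.1.2.2.2 hw.2 R hR)
      ⟨⟨hrate, hcont, hmild, hdiv⟩, hL⟩ ht hle
    calc _ ≤ K' * R ^ ((1 + α) / 2) * (-t) ^ (-((((1 + α) / 2) - 1) / 2)) := h
      _ ≤ (K' + C ^ 2 * V₁) * R ^ ((1 + α) / 2) * (-t) ^ (-((((1 + α) / 2) - 1) / 2)) := by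
          rw [mul_assoc, mul_assoc]; exact mul_le_mul_of_nonneg_right (by nlinarith) hX
  · have h := setIntegral_closedBall_norm_sq_le_of_small hrate (α := (1 + α) / 2) (by linarith) ht hR hlt.le
    calc _ ≤ C ^ 2 * V₁ * R ^ ((1 + α) / 2) * (-t) ^ (-((((1 + α) / 2) - 1) / 2)) := h
      _ ≤ (K' + C ^ 2 * V₁) * R ^ ((1 + α) / 2) * (-t) ^ (-((((1 + α) / 2) - 1) / 2)) := by
          rw [mul_assoc (K' + _), mul_assoc (C ^ 2 * V₁)]; exact mul_le_mul_of_nonneg_right (by linarith) hX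

/-! ### Uniform levels `α > 1` -/

/-- **UNIFORM LARGE-SCALE ENERGY BOOTSTRAP.**  For `C ≥ 0` and `1 < α ≤ 3` there is ONE constant `K = K(C, α) ≥ 0`
such that EVERY profile of the Type-I mild class with rate `C` satisfies
`∫_{B̄(0,R)} ‖v(t)‖² ≤ K · R^α · (−t)^{−(α−1)/2}` for all `t < 0`, `R > 0`. -/
theorem exists_uniform_level_of_gt_one (C : ℝ) (hC0 : 0 ≤ C) {α : ℝ} (hα : 1 < α) (hα3 : α ≤ 3) :
    ∃ K : ℝ, 0 ≤ K ∧
    ∀ v : ℝ → EuclideanSpace ℝ (Fin 3) → EuclideanSpace ℝ (Fin 3), HasTypeITimeDecay C v →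
      ContinuousOn (uncurry v) (Iio (0 : ℝ) ×ˢ univ) →
      (∀ s t : ℝ, s < t → t < 0 → ∀ x, v t x = heatExtension (v s) (t - s) x - oseenDuhamel 1 s v v t x) →
      (∀ t < 0, VectorCalculus.IsDivFree (v t)) →
      ∀ t < 0, ∀ R : ℝ, 0 < R →
        ∫ x in closedBall (0 : EuclideanSpace ℝ (Fin 3)) R, ‖v t x‖ ^ 2 ≤ K * R ^ α * (-t) ^ (-((α - 1) / 2)) := by
  -- the levels `α_n = 1 + 2^{-n}` with uniform constants
  have hseq : ∀ n : ℕ, ∃ K : ℝ, 0 ≤ K ∧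
      ∀ v : ℝ → EuclideanSpace ℝ (Fin 3) → EuclideanSpace ℝ (Fin 3), HasTypeITimeDecay C v →
        ContinuousOn (uncurry v) (Iio (0 : ℝ) ×ˢ univ) →
        (∀ s t : ℝ, s < t → t < 0 → ∀ x, v t x = heatExtension (v s) (t - s) x - oseenDuhamel 1 s v v t x) →
        (∀ t < 0, VectorCalculus.IsDivFree (v t)) →
        ∀ t < 0, ∀ R : ℝ, 0 < R →
          ∫ x in closedBall (0 : EuclideanSpace ℝ (Fin 3)) R, ‖v t x‖ ^ 2 ≤
            K * R ^ ((1 : ℝ) + (1 / 2 : ℝ) ^ n) * (-t) ^ (-(((1 : ℝ) + (1 / 2 : ℝ) ^ n - 1) / 2)) := by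
    intro n
    induction n with
    | zero =>
      have e : (1 : ℝ) + (1 / 2 : ℝ) ^ 0 = 2 := by norm_num
      rw [e]
      exact exists_uniform_levelTwo C hC0
    | succ n ih =>
      obtain ⟨K, hK0, hK⟩ := ih
      have hlt : (1 : ℝ) < (1 : ℝ) + (1 / 2 : ℝ) ^ n := by
        have : 0 < (1 / 2 : ℝ) ^ n := by positivity
        linarith
      have hlt3 : (1 : ℝ) + (1 / 2 : ℝ) ^ n < 3 := by
        have : (1 / 2 : ℝ) ^ n ≤ 1 := pow_le_one₀ (by norm_num) (by norm_num)
        linarith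
      have e : (1 : ℝ) + (1 / 2 : ℝ) ^ (n + 1) = (1 + ((1 : ℝ) + (1 / 2 : ℝ) ^ n)) / 2 := by
        rw [pow_succ]; ring
      rw [e]
      obtain ⟨K', hK'0, hK'⟩ := uniform_levelStepTwo C K _ hK0 hlt hlt3
      exact ⟨K', hK'0, fun v hrate hcont hmild hdiv => hK' v hrate hcont hmild hdiv (hK v hrate hcont hmild hdiv)⟩
  obtain ⟨n, hn⟩ := exists_pow_lt_of_lt_one (by linarith : 0 < α - 1) (by norm_num : (1 / 2 : ℝ) < 1)
  have hαn : (1 : ℝ) + (1 / 2 : ℝ) ^ n ≤ α := by linarith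
  obtain ⟨K, hK0, hK⟩ := hseq n
  set V₁ : ℝ := volume.real (closedBall (0 : EuclideanSpace ℝ (Fin 3)) 1) with hV₁
  have hV₁0 : 0 ≤ V₁ := measureReal_nonneg
  refine ⟨K + C ^ 2 * V₁, by positivity, fun v hrate hcont hmild hdiv t ht R hR => ?_⟩
  have hX : 0 ≤ R ^ α * (-t) ^ (-((α - 1) / 2)) :=
    mul_nonneg (Real.rpow_nonneg hR.le _) (Real.rpow_nonneg (by linarith) _)
  rcases le_or_gt (Real.sqrt (-t)) R with hle | hlt
  · calc _ ≤ K * R ^ ((1 : ℝ) + (1 / 2 : ℝ) ^ n) * (-t) ^ (-(((1 : ℝ) + (1 / 2 : ℝ) ^ n - 1) / 2)) :=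
          hK v hrate hcont hmild hdiv t ht R hR
      _ ≤ K * R ^ α * (-t) ^ (-((α - 1) / 2)) := level_mono hK0 hαn ht hle
      _ ≤ (K + C ^ 2 * V₁) * R ^ α * (-t) ^ (-((α - 1) / 2)) := by
          rw [mul_assoc, mul_assoc]; exact mul_le_mul_of_nonneg_right (by nlinarith) hX
  · have h := setIntegral_closedBall_norm_sq_le_of_small hrate hα3 ht hR hlt.le
    calc _ ≤ C ^ 2 * V₁ * R ^ α * (-t) ^ (-((α - 1) / 2)) := h
      _ ≤ (K + C ^ 2 * V₁) * R ^ α * (-t) ^ (-((α - 1) / 2)) := by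
          rw [mul_assoc (K + _), mul_assoc (C ^ 2 * V₁)]; exact mul_le_mul_of_nonneg_right (by linarith) hX

end Summit.NavierStokesRegularity.NavierStokesRegularity.Theorems.PoloidalWindowDoorPoloidalWindowRigidityLargeScaleEnergyBootstrapUniform

end
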